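import Summits.QuantumAdvantage.QuantumAdvantage.Theses.CubicForrelation
import Summits.QuantumAdvantage.QuantumAdvantage.Theorems.CubicForrelationSignedExactCubicForrelationNotPrBPPStubPlumbing
import Summits.QuantumAdvantage.QuantumAdvantage.Theorems.CubicForrelationSignedExactCubicForrelationNotPrBPPStubSignReadout

/-!
# Item `CubicForrelation.SignedExactCubicForrelationInPrBPP` (stmt-QuantumAdvantage-14671) modulo ONE finder

The support item stmt-QuantumAdvantage-14671 of route `QuantumAdvantage/CubicForrelation` is the route decl
`Summit.QuantumAdvantage.QuantumAdvantage.Theses.CubicForrelation.SignedExactCubicForrelationInPrBPP`: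
the signed EXACT slice of cubic `2`-fold Forrelation (yes `Φ = 1`, no `Φ = -1`; `k = 2`, `n` even,
`B₂`-circuits of 𝔽₂-degree `≤ 3`) lies in textbook `PromiseBPP'`. It is by `rfl` the statement
`signedExactCubicForrelationProblem 2 ∈ PromiseBPP'` and literally `¬` crux r3
`SignedExactCubicForrelationNotPrBPP` (stmt-QuantumAdvantage-13932).

This file records, as TREE theorems concluding the route decl BY NAME, exactly what the item is reduced
to after the landed stubs of the r3 line `dual-pingpong-frame`
(`Theorems.SignedExactCubicForrelationNotPrBPP.stub_plumbing`, `…stub_signReadout`):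

* `of_pairFinderExact` — the item follows from ONE hypothesis, a polynomial-time FUNCTION (`FP`) that maps
  the code of every exact cubic instance to rows spanning an M-subspace of its second function (the
  hypothesis of `stub_plumbing`, i.e. the line's `PairFinderExact`, verbatim);
* `of_pairFinderMM` — the same with the finder only required on instances whose second function lies on a
  completed Maiorana–McFarland orbit (the line's `PairFinderMM`, the conclusion of its one open stub
  `stub_finder`, verbatim) together with the route's support item `ExactPairsMaioranaMcFarland`
  (stmt-QuantumAdvantage-2205, crux r5) BY NAME, which puts every exact cubic pair on such an orbit
  (applied to `(f, g)` if `Φ = 1` and to `(¬f, g)` if `Φ = -1`).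

No new definition is introduced: the hypotheses are written in tree vocabulary (the line's `IsMSubspace`,
`spanSet`, `MMOrbit` unfolded), so that a proof of the open finder statement discharges them by `exact`.
References: [AaronsonAmbainis2018] S. Aaronson, A. Ambainis, Forrelation, SIAM J. Comput. 47 (2018),
§1.1.1 and §3.2 Prop. 6; [Carlet2020] C. Carlet, Boolean Functions for Cryptography and Coding Theory,
CUP 2021, Prop. 54 (Dillon's criterion) and Prop. 77 (McFarland dual); [Goldreich2006] O. Goldreich, On
promise problems, 2006, Def. 1.2.
-/

noncomputable section

set_option linter.dupNamespace false -- D-0017: single-problem summit ⇒ `QuantumAdvantage.QuantumAdvantage` by design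

namespace Summit.QuantumAdvantage.QuantumAdvantage.Theorems.SignedExactCubicForrelationInPrBPP

open Finset
open Literature.Computability.Complexity Literature.Computability.QuantumComplexity
open Literature.Computability.QuantumComplexity.BuzetChailloux (bxor zeroVec)
open Summit.QuantumAdvantage.QuantumAdvantage.Theses.CubicForrelation

/-- **The item modulo one finder.** If some `find ∈ FP` maps the code of every instance `I` with `k = 2`,
`n` even, `B₂`-circuits of degree `≤ 3` and `Φ = ±1` to the register code `encList L` of rows `L` whose
𝔽₂-row span `V` contains `0`, is closed under `⊕`, has `|V|² = 2ⁿ` and kills all second differences of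
the second function (an M-subspace), then the signed exact cubic slice is in `PromiseBPP'` — the route decl
`SignedExactCubicForrelationInPrBPP` by name. Proof: `stub_plumbing` (the deterministic slope/readout
machine and `PromiseProblem.mem_PromiseBPP'_of_fp_decider`) fed with `stub_signReadout` (one Poisson
summation), both landed for crux r3; the route decl is `signedExactCubicForrelationProblem 2 ∈ PromiseBPP'`
by `rfl`. [cite: AaronsonAmbainis2018, §1.1.1] [cite: Carlet2020, Prop. 77] [cite: Goldreich2006, Def. 1.2] -/
theorem of_pairFinderExact :
    (∃ find ∈ FP, ∀ (I : KForrelationInstance) (hk : I.k = 2), Even I.n → I.IsOverB2 →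
    (∀ i, IsDegLeFun 3 (I.C i).eval) → (I.value = 1 ∨ I.value = -1) →
    ∃ L : List (List Bool), find I.encode = encList L ∧
      ((zeroVec ∈ (@Finset.filter (Fin (I.n) → Bool) (fun v => (fun i => if v i then (1 : ZMod 2) else 0) ∈ F2Elim.rowSpan (I.n) L) (Classical.decPred _) Finset.univ) ∧ ∀ x ∈ (@Finset.filter (Fin (I.n) → Bool) (fun v => (fun i => if v i then (1 : ZMod 2) else 0) ∈ F2Elim.rowSpan (I.n) L) (Classical.decPred _) Finset.univ), ∀ y ∈ (@Finset.filter (Fin (I.n) → Bool) (fun v => (fun i => if v i then (1 : ZMod 2) else 0) ∈ F2Elim.rowSpan (I.n) L) (Classical.decPred _) Finset.univ), bxor x y ∈ (@Finset.filter (Fin (I.n) → Bool) (fun v => (fun i => if v i then (1 : ZMod 2) else 0) ∈ F2Elim.rowSpan (I.n) L) (Classical.decPred _) Finset.univ)) ∧ ((((@Finset.filter (Fin (I.n) → Bool) (fun v => (fun i => if v i then (1 : ZMod 2) else 0) ∈ F2Elim.rowSpan (I.n) L) (Classical.decPred _) Finset.univ)).card : ℝ) ^ 2 = (2 : ℝ)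 ^ (I.n)) ∧ (∀ u ∈ (@Finset.filter (Fin (I.n) → Bool) (fun v => (fun i => if v i then (1 : ZMod 2) else 0) ∈ F2Elim.rowSpan (I.n) L) (Classical.decPred _) Finset.univ), ∀ v ∈ (@Finset.filter (Fin (I.n) → Bool) (fun v => (fun i => if v i then (1 : ZMod 2) else 0) ∈ F2Elim.rowSpan (I.n) L) (Classical.decPred _) Finset.univ), ∀ x, ((I.C (Fin.cast hk.symm 1)).eval x ^^ (I.C (Fin.cast hk.symm 1)).eval (bxor x u) ^^ (I.C (Fin.cast hk.symm 1)).eval (bxor x v) ^^ (I.C (Fin.cast hk.symm 1)).eval (bxor x (bxor u v))) = false))) →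
    SignedExactCubicForrelationInPrBPP := by
  intro H
  show signedExactCubicForrelationProblem 2 ∈ PromiseBPP'
  exact SignedExactCubicForrelationNotPrBPP.stub_plumbing H SignedExactCubicForrelationNotPrBPP.stub_signReadout

/-- `Φ(¬f, g) = -Φ(f, g)` (companion of `DerivativeWalsh.forrelation_not_right`). [folklore] -/
theorem forrelation_not_left {n : ℕ} (f g : (Fin n → Bool) → Bool) :
    forrelation (fun x => !f x) g = -forrelation f g := by
  unfold forrelation
  rw [← mul_neg, ← Finset.sum_neg_distrib]
  congr 1
  refine Finset.sum_congr rfl fun x _ => ?_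
  rw [← Finset.sum_neg_distrib]
  refine Finset.sum_congr rfl fun y _ => ?_
  rw [DerivativeWalsh.signOf_not]
  ring

/-- **The item modulo the MM-orbit finder and crux r5.** If some `find ∈ FP` produces (rows spanning) an
M-subspace of `g = C 1` for every two-circuit instance `⟨m+m, 2, C⟩` over `B₂` with both functions of
degree `≤ 3`, `Φ = ±1`, and `g` on a completed Maiorana–McFarland orbit (`g ∘ e (y', y'') = y'·perm(y'') + h(y'')`
for an affine bijection `e` and a permutation `perm`), and if every exactly forrelated cubic pair has its
second function on such an orbit (route item `ExactPairsMaioranaMcFarland`, by name; used for `(f, g)` when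
`Φ = 1` and for `(¬f, g)` when `Φ = -1`, `forrelation_not_left`), then `SignedExactCubicForrelationInPrBPP`.
[cite: Carlet2020, Prop. 54 and Prop. 77] [cite: AaronsonAmbainis2018, §1.1.1] -/
theorem of_pairFinderMM :
    (∃ find ∈ FP, ∀ (m : ℕ) (C : Fin 2 → Circuit (Fin (m + m))),
      (⟨m + m, 2, C⟩ : KForrelationInstance).IsOverB2 →
      (∀ i, IsDegLeFun 3 (C i).eval) →
      (forrelation (C 0).eval (C 1).eval = 1 ∨ forrelation (C 0).eval (C 1).eval = -1) →
      (∃ e : (Fin (m + m) → Bool) ≃ (Fin (m + m) → Bool),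
        (∃ M : Matrix (Fin (m + m)) (Fin (m + m)) (ZMod 2), ∃ c : Fin (m + m) → ZMod 2,
          ∀ y i, (if e y i then (1 : ZMod 2) else 0) = (M.mulVec (fun j => if y j then (1 : ZMod 2) else 0) + c) i) ∧
        ∃ perm : (Fin m → Bool) ≃ (Fin m → Bool), ∃ h : (Fin m → Bool) → Bool, ∀ y' y'' : Fin m → Bool,
          (if (C 1).eval (e (Fin.append y' y'')) then (1 : ZMod 2) else 0) =
            (∑ i, (if y' i then (1 : ZMod 2) else 0) * (if perm y'' i then (1 : ZMod 2) else 0)) +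
              (if h y'' then (1 : ZMod 2) else 0)) →
      ∃ L : List (List Bool), find (KForrelationInstance.encode ⟨m + m, 2, C⟩) = encList L ∧
        ((zeroVec ∈ (@Finset.filter (Fin (m + m) → Bool) (fun v => (fun i => if v i then (1 : ZMod 2) else 0) ∈ F2Elim.rowSpan (m + m) L) (Classical.decPred _) Finset.univ) ∧ ∀ x ∈ (@Finset.filter (Fin (m + m) → Bool) (fun v => (fun i => if v i then (1 : ZMod 2) else 0) ∈ F2Elim.rowSpan (m + m) L) (Classical.decPred _) Finset.univ), ∀ y ∈ (@Finset.filter (Fin (m + m) → Bool) (fun v => (fun i => if v i then (1 : ZMod 2) else 0) ∈ F2Elim.rowSpan (m + m) L) (Classical.decPred _) Finset.univ), bxor x y ∈ (@Finset.filter (Fin (m + m) → Bool) (fun v => (fun i => if v i then (1 : ZMod 2) else 0) ∈ F2Elim.rowSpan (m + m) L) (Classical.decPred _) Finset.univ)) ∧ ((((@Finset.filter (Fin (m + m) → Bool) (fun v => (fun i => if v i then (1 : ZMod 2) else 0) ∈ F2Elim.rowSpan (m + m) L) (Classical.decPred _) Finset.univ)).card : ℝ) ^ 2 = (2 : ℝ)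 ^ (m + m)) ∧ (∀ u ∈ (@Finset.filter (Fin (m + m) → Bool) (fun v => (fun i => if v i then (1 : ZMod 2) else 0) ∈ F2Elim.rowSpan (m + m) L) (Classical.decPred _) Finset.univ), ∀ v ∈ (@Finset.filter (Fin (m + m) → Bool) (fun v => (fun i => if v i then (1 : ZMod 2) else 0) ∈ F2Elim.rowSpan (m + m) L) (Classical.decPred _) Finset.univ), ∀ x, ((C 1).eval x ^^ (C 1).eval (bxor x u) ^^ (C 1).eval (bxor x v) ^^ (C 1).eval (bxor x (bxor u v))) = false))) →
    ExactPairsMaioranaMcFarland → SignedExactCubicForrelationInPrBPP := by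
  rintro ⟨find, hfind, hspec⟩ h5
  refine of_pairFinderExact ⟨find, hfind, ?_⟩
  rintro ⟨n, k, C⟩ hk heven hB hdeg hv
  dsimp only at hk heven hB hdeg hv ⊢
  subst hk
  obtain ⟨m, rfl⟩ := heven
  rw [KForrelationInstance.value_mk_two] at hv
  have horb : ∃ e : (Fin (m + m) → Bool) ≃ (Fin (m + m) → Bool),
      (∃ M : Matrix (Fin (m + m)) (Fin (m + m)) (ZMod 2), ∃ c : Fin (m + m) → ZMod 2,
        ∀ y i, (if e y i then (1 : ZMod 2) else 0) = (M.mulVec (fun j => if y j then (1 : ZMod 2) else 0) + c) i) ∧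
      ∃ perm : (Fin m → Bool) ≃ (Fin m → Bool), ∃ h : (Fin m → Bool) → Bool, ∀ y' y'' : Fin m → Bool,
        (if (C 1).eval (e (Fin.append y' y'')) then (1 : ZMod 2) else 0) =
          (∑ i, (if y' i then (1 : ZMod 2) else 0) * (if perm y'' i then (1 : ZMod 2) else 0)) +
            (if h y'' then (1 : ZMod 2) else 0) := by
    rcases hv with h | h
    · exact h5 m _ _ (hdeg 0) (hdeg 1) h
    · refine h5 m (fun x => !(C 0).eval x) _ (hdeg 0).not (hdeg 1) ?_
      rw [forrelation_not_left, h, neg_neg]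
  exact hspec m C hB hdeg hv horb

/-- Sanity (by name): the item is literally the negation of crux r3 `SignedExactCubicForrelationNotPrBPP`. -/
example : SignedExactCubicForrelationInPrBPP ↔ ¬ SignedExactCubicForrelationNotPrBPP := by
  unfold SignedExactCubicForrelationInPrBPP SignedExactCubicForrelationNotPrBPP
  exact not_not.symm

/-! ## Glue by name (appended 2026-08-16): the item is `¬` crux r3 and follows from support r7 -/

/-- **Item ↔ ¬ crux r3.** `SignedExactCubicForrelationInPrBPP` is literally the negation of
`SignedExactCubicForrelationNotPrBPP` (stmt-QuantumAdvantage-13932): both unfold to (non-)membership of the same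
promise problem `signedExactCubicForrelationProblem 2` in `PromiseBPP'`. So the item closes `proved` by `.mpr` the
moment r3 is refuted, and is refuted by `fun h => (iff_not_notPrBPP.mp hItem) h` the moment r3 is proved.
[cite: AaronsonAmbainis2018, §3.2 Prop. 6] -/
theorem iff_not_notPrBPP : SignedExactCubicForrelationInPrBPP ↔ ¬ SignedExactCubicForrelationNotPrBPP := by
  unfold SignedExactCubicForrelationInPrBPP SignedExactCubicForrelationNotPrBPP
  exact not_not.symm

/-- **Support r7 ⇒ item** (antitonicity of `PromiseBPP'` in the promise): if the signed cubic `2`-fold problem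
(yes `Φ ≥ 3/5`, no `Φ ≤ -3/5`; route decl `SignedCubicForrelationInPrBPP`, stmt-QuantumAdvantage-13933) is in
`PromiseBPP'`, then so is its sub-promise, the signed exact slice — the contrapositive of
`signedCubicForrelationProblem_not_mem_PromiseBPP'_of_exact` at `k₀ = 2` (both route decls are the tree's promise
problems by `rfl`, `signedCubicForrelationProblem_two_eq` / `signedExactCubicForrelationProblem_two_eq`).
[cite: Goldreich2006, §1.1–1.2] [cite: AaronsonAmbainis2018, §1.1.3] -/
theorem of_signedCubicForrelationInPrBPP : SignedCubicForrelationInPrBPP → SignedExactCubicForrelationInPrBPP := by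
  intro h7
  show signedExactCubicForrelationProblem 2 ∈ PromiseBPP'
  by_contra h
  exact signedCubicForrelationProblem_not_mem_PromiseBPP'_of_exact 2 h h7

end Summit.QuantumAdvantage.QuantumAdvantage.Theorems.SignedExactCubicForrelationInPrBPP

end
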